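import Summits.BirchSwinnertonDyer.BirchSwinnertonDyer.Theorems.Rank1ResidualJetSwapStep
import Summits.BirchSwinnertonDyer.BirchSwinnertonDyer.Theorems.ClassRecordThreeEulerHalvesAtThreeWalkSupplyGross1991Scoped
import Summits.BirchSwinnertonDyer.BirchSwinnertonDyer.Theorems.Rank1ResidualJetSwapStepKolyvagin
import Summits.BirchSwinnertonDyer.BirchSwinnertonDyer.Theorems.PrintX9JetchevSplitStringent
import Summits.BirchSwinnertonDyer.BirchSwinnertonDyer.Theorems.PrintX9JetchevSplitProp47
import Summits.BirchSwinnertonDyer.BirchSwinnertonDyer.Theorems.PrintX9JetchevSplitBricks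
import Summits.BirchSwinnertonDyer.BirchSwinnertonDyer.Theorems.KatoDescentTamePotSupersingularJetchevIrreducibleCoreVertexRootClass
import Summits.BirchSwinnertonDyer.BirchSwinnertonDyer.Theorems.ClassRecordThreeShimuraKolyvaginFixedOfTorsion
import Summits.BirchSwinnertonDyer.Rank1Residual.X9.LeafDischarge
import Literature.NumberTheory.EllipticCurves.BSDSelmerCMPConverseHeegnerFieldProofs
import HarnessLib

/-!
# Route `PrintX9`, crux J = `HeegnerDivisibilityX9` (item 20392), stub `stub_jetchevX9` — the X9 SWAP, brick 2b inputs: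
# the root class in `H_{𝓕(s)}` at irreducible image with `p` split, and McCallum Prop. 4.4 in the cast form from
# Gross 1991 Prop. 3.7 (2) (inputs of the `λ₀` half `not_dvd_of_swap_classX9`, sequel file)

Cell `bsd-print-x9` (print tier, key `x9`), prover seat p4; `--supports stmt-BirchSwinnertonDyer-20392`,
helper; THEOREMS ONLY, nothing booked, no item closed, BSD is not proved by any of this.

WHAT (this file = §0, §1; the sequel `PrintX9JetchevX9SwapStep` = §2). §0 `rootClass_mem_selmerGroup_selmerF_of_levelUp_split` — the root class `c_k(Q)` of a `p^u`-th root of `P_s`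
lies in `H_{𝓕(s)}` (stepL's `Walk.rootClass_mem_selmerGroup_selmerF_of_levelUp_kolyvagin` with the admissibility mod
`p^{k+u}` a HYPOTHESIS `hA` and the image uses fed by potss' `_of_admissible` root-class lemmas and this seat's split
Kummer brick). §1 `addOrderOf_localization_kolyvaginClass_eq_of_prop37_2_cast_split` — Prop. 4.4 in the cast form
(`n''·ℓ₀ = n·ℓ'`) from Gross 3.7 (2). §2 `not_dvd_of_swap_classX9` — bsd-jet's `Swap.not_dvd_of_swap_kolyvagin` (McCallum
p. 306 run at level `p` on the root classes: Prop. 4.4 at `λ'`, the root class `y` NOT Kummer at `λ'`, the EXCLUSION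
LEMMA `Swap.localization_eq_zero_of_strict_of_relaxed` (image-free), Prop. 4.4 at `λ₀`) with `(hcm, hp2, htower, h44)`
replaced by `(hX9 : ClassX9 W p, hHp : SatisfiesHeegnerHypothesis p K, h37 : GrossLMS1991.prop37_2_frobeniusCongruence)`;
proof byte-for-byte up to the six image touchpoints (Prop. 4.4 ×2 from `h37`, root class/sign/`ι_*`-injectivity from
irreducibility + `p` split, §0). CONDITIONAL on the displayed structure inputs and `h37`; nothing asserted.
References (locators only): [cite: McCallumLMS1991, §5 proof of Prop. 5.2 (pp. 305–306), §4 Prop. 4.4]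
[cite: Jetchev2008, §3.1 item 7, Lemma 5.2, Thm. 5.1] [cite: GrossLMS1991, Prop. 3.7 (2), §6 Prop. 6.2 (1)]
[cite: GrossZagier1986, III (3.1)] [cite: Howard2004HeegnerKolyvagin, Lemma 2.7.3, Thm. 2.1.11].
-/


set_option autoImplicit false

noncomputable section
open scoped Classical Pointwise
open Function NumberField IsDedekindDomain WeierstrassCurve Field
open Literature.NumberTheory.EllipticCurves Literature.NumberTheory.GaloisRepresentations
open Literature.NumberTheory.EllipticCurves.Jetchev2008 Literature.NumberTheory.EllipticCurves.KolyvaginCocycle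
open Literature.NumberTheory.EllipticCurves.ModularForms
open Literature.NumberTheory.GaloisCohomology Literature.NumberTheory.Automorphic
open Literature.NumberTheory.GaloisRepresentations.DiscreteGaloisModule (transverseSubgroup SelmerStructure)
open Summit.BirchSwinnertonDyer.Rank1Residual.JET.SelmerVocabulary
open Summit.BirchSwinnertonDyer.Rank1Residual.JET.GlobalDuality
open Summit.BirchSwinnertonDyer.Rank1Residual.X11b
open Summit.BirchSwinnertonDyer.Rank1Residual.X11b.Three
open Summit.BirchSwinnertonDyer.BirchSwinnertonDyer.Theorems
open Literature.NumberTheory.EllipticCurves.Rank1Residual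
open Summit.BirchSwinnertonDyer.Rank1Residual.JET.Swap

namespace Summit.BirchSwinnertonDyer.Rank1Residual.JET.Split

variable {K : Type} [Field K] [NumberField K] (W : WeierstrassCurve ℚ) [W.IsElliptic]
  [W.IsGloballyMinimal] [NeZero (W.conductorNorm ℤ)]

section Selmer

variable {Dt : ModularParametrizationData W (W.conductorNorm ℤ)} {β : ℤ} {ι : K →+* ℂ}
  {p : ℕ} [Fact p.Prime] {k : ℕ} [∀ j : ℕ, NumberField (ringClassField K ι j)]
  {𝒯 : SelmerStructure ((W.baseChange K).torsionGaloisModule ((p ^ k : ℕ) : ℤ))}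
  (h𝒯 : ∀ v : HeightOneSpectrum (𝓞 K), 𝒯 (Sum.inr v) =
    ⨅ (ℓ : ℕ) (_ : ℓ.Prime ∧ (ℓ : 𝓞 K) ∈ v.asIdeal),
      ⨅ (w' : HeightOneSpectrum (𝓞 (ringClassField K ι ℓ)))
        (_ : w'.asIdeal.LiesOver v.asIdeal),
        letI := (adicCompletionOfLiesOver K (ringClassField K ι ℓ) v w').toAlgebra
        transverseSubgroup (GaloisRep.toLocal v ((W.baseChange K).torsionGaloisModule ((p ^ k : ℕ) : ℤ)))
          (w'.adicCompletion (ringClassField K ι ℓ)))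

include h𝒯 in
/-- **§0 The root class `c_k(Q)` of a `p^u`-th root of `P_s` lies in `H_{𝓕(s)}`, irreducible image, `p` split** — stepL's
`Walk.rootClass_mem_selmerGroup_selmerF_of_levelUp_kolyvagin` with `ρ̄ onto` replaced by `(hirr, hHp)` and the admissibility
of `E(K[s]) ⊆ E(K̄)` mod `p^{k+u}` an explicit hypothesis `hA`: Kummer part by potss' image-agnostic
`localization_rootClass_mem_kummer_of_admissible` over this seat's split Kummer brick, transverse part by
`localization_rootClass_mem_globalTransverse_of_admissible`. [cite: Jetchev2008, §3.1 item 7 (p. 817), Prop. 4.5–4.6]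
[cite: GrossLMS1991, §6 Prop. 6.2 (1)] [cite: GrossZagier1986, III (3.1)] [cite: Howard2004HeegnerKolyvagin, Lemma 2.7.3] -/
theorem rootClass_mem_selmerGroup_selmerF_of_levelUp_split (hK : IsImaginaryQuadratic K)
    (hD3 : NumberField.discr K ≠ -3) (hD4 : NumberField.discr K ≠ -4)
    (hH : SatisfiesHeegnerHypothesis (W.conductorNorm ℤ) K) (hp2 : p ≠ 2)
    (hirr : W.HasIrreducibleModPGaloisRep p) (hHp : SatisfiesHeegnerHypothesis p K)
    {n' : ℤ} (hcop' : IsCoprime (p : ℤ) n')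
    (hGZ : ∀ (m : ℕ), Squarefree m →
      (∀ q ∈ m.primeFactors, Zhang2014.IsKolyvaginPrime (W.conductorNorm ℤ) W K p q) →
      ∀ (dm : KolyvaginHeegnerData Dt β ι m)
      (γ : ringClassField K ι m ≃ₐ[ℚ] ringClassField K ι m), γ ∈ ringClassGal ι m →
      ∀ v : HeightOneSpectrum (𝓞 K), ¬ (W.baseChange K).HasGoodReductionAt v →
        n' • pointsMap (W.baseChange K) (v.adicCompletion K)
            (dm.toGeomPoints (pointGalHom W (ringClassField K ι m) γ dm.y)) ∈
          E0Receptacle (W.baseChange K) v ∧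
        ∀ (ℓ : ℕ), ℓ ∈ m.primeFactors → ∀ (dm' : KolyvaginHeegnerData Dt β ι (m / ℓ))
          (hle : ringClassField K ι (m / ℓ) ≤ ringClassField K ι m),
          n' • pointsMap (W.baseChange K) (v.adicCompletion K)
              (dm.toGeomPoints (pointGalHom W (ringClassField K ι m) γ
                (WeierstrassCurve.Affine.Point.map (W' := W)
                  ((RingClassField.inclusion ι hle).restrictScalars ℚ) dm'.y))) ∈
            E0Receptacle (W.baseChange K) v)
    {s : ℕ} (hs : Squarefree s) {u : ℕ}
    (hsK : ∀ ℓ ∈ s.primeFactors, Zhang2014.IsKolyvaginPrime (W.conductorNorm ℤ) W K p ℓ ∧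
      k + u ≤ Zhang2014.kolyvaginIndex W p ℓ)
    (d : KolyvaginHeegnerData Dt β ι s)
    (hA : IsAdmissible (absoluteGaloisGroup K) d.pointsSubgroup ((p ^ (k + u) : ℕ) : ℤ))
    (Q : (W.baseChange (ringClassField K ι s)).toAffine.Point)
    (hAk : IsAdmissible (absoluteGaloisGroup K) d.pointsSubgroup ((p ^ k : ℕ) : ℤ))
    (hQ : d.toGeomPoints Q ∈ invPoints (absoluteGaloisGroup K) d.pointsSubgroup ((p ^ k : ℕ) : ℤ))
    (hQP : ((p ^ u : ℕ) : ℤ) • Q = d.derivedPoint)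
    (hP : d.toGeomPoints d.derivedPoint ∈
      invPoints (absoluteGaloisGroup K) d.pointsSubgroup ((p ^ (k + u) : ℕ) : ℤ))
    (htr : ∀ ℓ ∈ s.primeFactors,
      (d.kolyvaginClass (Fact.out : p.Prime) (k + u) :
        galoisCohomology ((W.baseChange K).torsionGaloisModule ((p ^ (k + u) : ℕ) : ℤ)) 1) ∈
        transverseKer W K ι ((p ^ (k + u) : ℕ) : ℤ) ℓ) :
    (kolyvaginClass (W.baseChange K) ((p ^ k : ℕ) : ℤ)
        ((W.baseChange K).zsmul_geomPoints_surjective_of_charZero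
          (by exact_mod_cast pow_ne_zero k (Fact.out : p.Prime).ne_zero)) hAk (d.toGeomPoints Q) hQ) ∈
      (selmerF W ((p ^ k : ℕ) : ℤ) 𝒯 (placesDividing K s)).selmerGroup := by
  have hp : p.Prime := Fact.out
  have hs0 : s ≠ 0 := hs.ne_zero
  -- Kummer condition at every place not over a prime of `s`, at level `k + u`, then pulled back
  have hKum : ∀ v : Place K, (∀ ℓ ∈ s.primeFactors, ¬ PlaceOver K v ℓ) →
      galoisCohomology.localization ((W.baseChange K).torsionGaloisModule ((p ^ k : ℕ) : ℤ)) v 1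
        (kolyvaginClass (W.baseChange K) ((p ^ k : ℕ) : ℤ)
          ((W.baseChange K).zsmul_geomPoints_surjective_of_charZero
            (by exact_mod_cast pow_ne_zero k hp.ne_zero)) hAk (d.toGeomPoints Q) hQ) ∈
        (W.baseChange K).kummerSelmerStructure ((p ^ k : ℕ) : ℤ) v := by
    intro v hv
    refine JetchevIrreducibleCoreVertex.localization_rootClass_mem_kummer_of_admissible W hp d k u hA Q hAk hQ hQP hP v ?_
    exact localization_kolyvaginClass_mem_kummerSelmerStructure_of_GZ31_of_irreducible_of_split_kolyvagin
      (phi_heegnerPointOfConductor_mem_range_map_ringClassField_holds (W.conductorNorm ℤ) W K)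
      exists_generator_ringClassGalOver_holds hK hD3 hD4 hH hp2 hirr hHp Dt β ι hcop' hGZ hs hsK d v hv
  exact (mem_selmerGroup_selmerF_iff W _ 𝒯 hs0 _).mpr
    ⟨hKum, JetchevIrreducibleCoreVertex.localization_rootClass_mem_globalTransverse_of_admissible W h𝒯 hK hs hsK d
      hA Q hAk hQ hQP hP htr⟩

end Selmer

/-- **§1 McCallum Prop. 4.4 (localisation currency) with the datum of conductor `mℓ` given at `N = mℓ`, on a split row, from
Gross 1991 Prop. 3.7 (2)** (bsd-jet's `Swap.addOrderOf_localization_kolyvaginClass_eq_of_prop44_cast` with `h44, htower`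
replaced by `h37, hirr, hHp`; `ℓ ≠ 2`). [cite: McCallumLMS1991, §4 Prop. 4.4 (p. 301)] [cite: GrossLMS1991, Prop. 3.7 (2)] -/
theorem addOrderOf_localization_kolyvaginClass_eq_of_prop37_2_cast_split
    (h37 : GrossLMS1991.prop37_2_frobeniusCongruence)
    (hK : IsImaginaryQuadratic K)
    (hD3 : NumberField.discr K ≠ -3) (hD4 : NumberField.discr K ≠ -4)
    (hH : SatisfiesHeegnerHypothesis (W.conductorNorm ℤ) K)
    (p : ℕ) [Fact p.Prime] (hp2 : p ≠ 2) (hirr : W.HasIrreducibleModPGaloisRep p)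
    (hHp : SatisfiesHeegnerHypothesis p K)
    (Dt : ModularParametrizationData W (W.conductorNorm ℤ)) (β : ℤ) (ι : K →+* ℂ)
    (M : ℕ) (hM : 1 ≤ M) {m l N : ℕ} (hN : m * l = N) (hml : Squarefree N) (hl : l.Prime) (hl2 : l ≠ 2)
    (hlm : ¬ l ∣ m)
    (hK' : ∀ l' ∈ N.primeFactors, Zhang2014.IsKolyvaginPrime (W.conductorNorm ℤ) W K p l' ∧
      M ≤ Zhang2014.kolyvaginIndex W p l')
    (d : KolyvaginHeegnerData Dt β ι m) (d' : KolyvaginHeegnerData Dt β ι N)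
    (hσ : ∀ l' ∈ m.primeFactors, ∀ (x : ringClassField K ι m) (x' : ringClassField K ι N),
      (x : ℂ) = x' → ((d'.σ l' x' : ringClassField K ι N) : ℂ) = (d.σ l' x : ℂ))
    (hS : ∀ s ∈ d.S, ∃ s' ∈ d'.S, ∀ (x : ringClassField K ι m) (x' : ringClassField K ι N),
      (x : ℂ) = x' → ((s' x' : ringClassField K ι N) : ℂ) = (s x : ℂ))
    (hS' : ∀ s' ∈ d'.S, ∃ s ∈ d.S, ∀ (x : ringClassField K ι m) (x' : ringClassField K ι N),
      (x : ℂ) = x' → ((s' x' : ringClassField K ι N) : ℂ) = (s x : ℂ))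
    (hemb : ∀ (x : ringClassField K ι m) (x' : ringClassField K ι N), (x : ℂ) = x' → d'.emb x' = d.emb x)
    (v : HeightOneSpectrum (𝓞 K)) (hv : (l : 𝓞 K) ∈ v.asIdeal) :
    addOrderOf ((galoisCohomology.localization
        ((W.baseChange K).torsionGaloisModule ((p ^ M : ℕ) : ℤ)) (Sum.inr v) 1 :
          galH1Torsion (W.baseChange K) ((p ^ M : ℕ) : ℤ) →+ _)
        (d'.kolyvaginClass (Fact.out : p.Prime) M)) =
      addOrderOf ((galoisCohomology.localization
        ((W.baseChange K).torsionGaloisModule ((p ^ M : ℕ) : ℤ)) (Sum.inr v) 1 :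
          galH1Torsion (W.baseChange K) ((p ^ M : ℕ) : ℤ) →+ _)
        (d.kolyvaginClass (Fact.out : p.Prime) M)) := by
  subst hN
  exact addOrderOf_localization_kolyvaginClass_mul_eq_of_prop37_2_of_split h37 W K hK hD3 hD4 hH p hp2 hirr hHp
    Dt β ι M hM m l hml hl hl2 hlm hK' d d' hσ hS hS' hemb v hv

end Summit.BirchSwinnertonDyer.Rank1Residual.JET.Split

end
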